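import Literature.MathematicalPhysics.QuantumFieldTheory.Balaban1983to89.Beta.AveragingMixedJetTables

/-!
# `BalabanUV.Beta.TruncatedNil4Calculus` — binder row D1, AVG-LETTERS chain (an1's plan l.11915, module M2a §1):
# THE EXACT TRUNCATED `exp` / `log` / INVERSE CALCULUS MODULO A NIL-4 AUGMENTATION

HONEST FRAMING (cell charter, verbatim): «discharging BetaPertH makes Balaban's UV stability UNCONDITIONAL — a real
constructive-QFT result; it is NOT the continuum limit and NOT the Clay problem.»
HONEST DEPENDENCY: continuum YM on T⁴ ⇐ BetaPertH ∧ nine spine estimates (0/9 proved); BetaPertH ⇐ (D1) ∧ (D4) ∧ CAP+tail;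
G-an2-4 gates asym, D1 and NE2/3/4.
DERIVED cell leaf ([folklore] ring algebra): node 12's truncated series `AveragingThirdJet.expT/logT/invT` are EXACT inverse ∕
exponential ∕ logarithm maps on the coset `1 + 𝔪` resp. on `𝔪` of ANY `𝕜`-algebra `R` with an augmentation `ag : R →ₐ[𝕜] R₀` whose
kernel `𝔪` has vanishing FOURFOLD products (hypothesis `h4`, carried as a binder — no definition, no `Prop` fact is minted); the
instance of record is node 12's `Rho 𝔸` with `augR` (`nil4_augR`, generalising `Rho.nil4` to four distinct factors).  Nothing of
Bałaban's papers is typed; no binder of the wall (hW ∕ hR ∕ D1Tel ∕ D1Rep) is touched.  NOT D1, NOT BetaPertH, NOT continuum, NOT Clay.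

## Contents (all under `h4 : ∀ a b c e, ag a = 0 → ag b = 0 → ag c = 0 → ag e = 0 → a * b * c * e = 0`)
* §1 inverses: `mul_invT_eq_one` ∕ `invT_mul_eq_one` (`ag g = 1`), `inv_unique`, `eq_invT_of_mul_eq_one` (left or right inverses ARE
  `invT g`), `aug_invT_eq_one`, `invT_invT`, `invT_mul_rev` (`invT (g h) = invT h · invT g`).
* §2 exponentials as evaluations of explicit cubics in `𝕜[X]` (`expT_eq_aeval`, `logT_eq_aeval`, `invT_sub_one_eq_aeval`); with `(2 : 𝕜) ≠ 0`:
  `expT_neg_mul_expT` ∕ `expT_mul_expT_neg` (`ag x = 0`), `invT_expT` (`invT (expT x) = expT (−x)`), `logT_invT` (`logT (invT g) = −logT g`,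
  `ag g = 1`); with `(2 : 𝕜) ≠ 0`, `(3 : 𝕜) ≠ 0`: `logT_expT` (`logT (expT x) = x`), `expT_logT` (`expT (logT g) = g`) — `expT : 𝔪 → 1 + 𝔪` and
  `logT : 1 + 𝔪 → 𝔪` are mutually inverse BIJECTIONS.
* §3 augmentation one: `aug_holG_eq_one` (transporters `≡ 1 mod 𝔪` on the letters), `aug_PhiGAt_eq_one` (node 12b's rooted averaging).
* §4 the instance `Rho 𝔸`, `augR`: `nil4_augR`.
Provenance: β sub-cell, D1 formalisation swarm, unit b2b-balaban-beta-d1-formalise-leaf-05 gen 7, 2026-08-20 (v1); no existing file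
touched.
-/

namespace Summit.QuantumFields.BalabanUV.Beta.TruncatedNil4Calculus

open Finset
open scoped BigOperators
open Literature.MathematicalPhysics.QuantumFieldTheory.Balaban1983to89.Beta
open AffineAveraging (Form1)
open AveragingHessianKernels (LettersIn)
open AveragingThirdJet (expT logT invT map_expT map_logT map_invT mul_invT invT_mul expT_zero logT_one invT_one
  LetterGrp δ holG map_holG holG_one Rho augR augR_apply dfst_mul dsnd_mul)
open AveragingThirdJet.Tau (c00 mul3_eq_zero mul4_eq_zero_l mul4_eq_zero_m mul4_eq_zero_r)
open AveragingMixedJetTables (PhiGAt map_PhiGAt PhiGAt_one lettersIn_loopCAt_top lettersIn_segUp_top)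

variable {𝕜 : Type*} [Field 𝕜] {R R₀ : Type*} [Ring R] [Algebra 𝕜 R] [Ring R₀] [Algebra 𝕜 R₀]

/-! ## §1 Inverses modulo fourth powers of the augmentation ideal -/

section Inverses

variable {ag : R →ₐ[𝕜] R₀}
  (h4 : ∀ a b c e : R, ag a = 0 → ag b = 0 → ag c = 0 → ag e = 0 → a * b * c * e = 0)
include h4

/-- [folklore] `g · invT g = 1` when `ag g = 1` (the fourth power of `g − 1 ∈ 𝔪` vanishes). -/
theorem mul_invT_eq_one {g : R} (hg : ag g = 1) : g * invT g = 1 := by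
  have h0 : ag (g - 1) = 0 := by rw [map_sub, map_one, hg, sub_self]
  rw [mul_invT, h4 _ _ _ _ h0 h0 h0 h0, sub_zero]

/-- [folklore] `invT g · g = 1` when `ag g = 1`. -/
theorem invT_mul_eq_one {g : R} (hg : ag g = 1) : invT g * g = 1 := by
  have h0 : ag (g - 1) = 0 := by rw [map_sub, map_one, hg, sub_self]
  rw [invT_mul, h4 _ _ _ _ h0 h0 h0 h0, sub_zero]

omit h4 in
/-- [folklore] Uniqueness of inverses in any monoid: a left inverse and a right inverse of the same element coincide. -/
theorem inv_unique {g u v : R} (hu : u * g = 1) (hv : g * v = 1) : u = v := by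
  calc u = u * (g * v) := by rw [hv, mul_one]
    _ = (u * g) * v := by rw [mul_assoc]
    _ = v := by rw [hu, one_mul]

/-- [folklore] A RIGHT inverse of `g` (`ag g = 1`) is `invT g`. -/
theorem eq_invT_of_mul_eq_one {g v : R} (hg : ag g = 1) (hv : g * v = 1) : v = invT g :=
  (inv_unique (invT_mul_eq_one h4 hg) hv).symm

/-- [folklore] A LEFT inverse of `g` (`ag g = 1`) is `invT g`. -/
theorem eq_invT_of_mul_eq_one' {g u : R} (hg : ag g = 1) (hu : u * g = 1) : u = invT g :=
  inv_unique hu (mul_invT_eq_one h4 hg)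

omit h4 in
/-- [folklore] `ag (invT g) = invT (ag g)`; in particular `= 1` when `ag g = 1`. -/
theorem aug_invT_eq_one {g : R} (hg : ag g = 1) : ag (invT g) = 1 := by
  rw [map_invT, hg, invT_one]

/-- [folklore] `invT` is an involution on `1 + 𝔪`. -/
theorem invT_invT {g : R} (hg : ag g = 1) : invT (invT g) = g :=
  (eq_invT_of_mul_eq_one h4 (aug_invT_eq_one hg) (invT_mul_eq_one h4 hg)).symm

/-- [folklore] `invT (g · h) = invT h · invT g` on `1 + 𝔪`. -/
theorem invT_mul_rev {g h : R} (hg : ag g = 1) (hh : ag h = 1) : invT (g * h) = invT h * invT g := by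
  have hgh : ag (g * h) = 1 := by rw [map_mul, hg, hh, one_mul]
  refine (eq_invT_of_mul_eq_one h4 hgh ?_).symm
  calc g * h * (invT h * invT g) = g * (h * invT h) * invT g := by simp only [mul_assoc]
    _ = 1 := by rw [mul_invT_eq_one h4 hh, mul_one, mul_invT_eq_one h4 hg]

/-- [folklore] Cancellation: `g · a = g · b → a = b` for `ag g = 1`. -/
theorem mul_left_cancel_of_aug {g a b : R} (hg : ag g = 1) (h : g * a = g * b) : a = b := by
  have := congrArg (fun t => invT g * t) h
  simpa only [← mul_assoc, invT_mul_eq_one h4 hg, one_mul] using this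

end Inverses

/-! ## §2 The truncated exponential and logarithm -/

section ExpLog

open Polynomial

/-- [folklore] `expT x` is the evaluation at `x` of the cubic `1 + X + X²/2 + X³/6 ∈ 𝕜[X]`. -/
theorem expT_eq_aeval (x : R) :
    expT 𝕜 x = aeval x (1 + X + C (2 : 𝕜)⁻¹ * X ^ 2 + C (6 : 𝕜)⁻¹ * X ^ 3 : 𝕜[X]) := by
  unfold expT
  simp only [map_add, map_one, map_mul, aeval_X, aeval_C, Algebra.smul_def, pow_succ, pow_zero, one_mul, mul_assoc]

/-- [folklore] `logT g` is the evaluation at `g − 1` of the cubic `X − X²/2 + X³/3 ∈ 𝕜[X]`. -/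
theorem logT_eq_aeval (g : R) :
    logT 𝕜 g = aeval (g - 1) (X - C (2 : 𝕜)⁻¹ * X ^ 2 + C (3 : 𝕜)⁻¹ * X ^ 3 : 𝕜[X]) := by
  unfold logT
  simp only [map_add, map_sub, map_mul, aeval_X, aeval_C, Algebra.smul_def, pow_succ, pow_zero, one_mul, mul_assoc]

/-- [folklore] `invT g − 1` is the evaluation at `g − 1` of `−X + X² − X³`. -/
theorem invT_sub_one_eq_aeval (g : R) : invT g - 1 = aeval (g - 1) (-X + X ^ 2 - X ^ 3 : 𝕜[X]) := by
  simp only [map_add, map_sub, map_neg, map_pow, aeval_X]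
  unfold invT
  simp only [pow_succ, pow_zero, one_mul]
  abel

variable {ag : R →ₐ[𝕜] R₀}
  (h4 : ∀ a b c e : R, ag a = 0 → ag b = 0 → ag c = 0 → ag e = 0 → a * b * c * e = 0)
include h4

/-- [folklore] Fourth powers vanish on `𝔪`. -/
theorem pow_four_eq_zero {x : R} (hx : ag x = 0) : x ^ 4 = 0 := by
  rw [show x ^ 4 = x * x * x * x by simp only [pow_succ, pow_zero, one_mul]]
  exact h4 _ _ _ _ hx hx hx hx

/-- [folklore] **`expT (−x) · expT x = 1`** for `x ∈ 𝔪` (characteristic `≠ 2`): in `𝕜[X]`,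
`E(−X)·E(X) = 1 + (2·2⁻¹ − 1)·X² + X⁴·(2⁻²− 2·6⁻¹ − 6⁻²·X²)`, the `X²`-coefficient vanishes and `x⁴ = 0`. -/
theorem expT_neg_mul_expT (h2 : (2 : 𝕜) ≠ 0) {x : R} (hx : ag x = 0) : expT 𝕜 (-x) * expT 𝕜 x = 1 := by
  set p : 𝕜[X] := 1 + X + C (2 : 𝕜)⁻¹ * X ^ 2 + C (6 : 𝕜)⁻¹ * X ^ 3 with hp
  have e1 : expT 𝕜 (-x) = aeval x (p.comp (-X)) := by
    rw [aeval_comp, map_neg, aeval_X, expT_eq_aeval]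
  have key : p.comp (-X) * p = 1 + (2 * C (2 : 𝕜)⁻¹ - 1) * X ^ 2
      + X ^ 4 * (C (2 : 𝕜)⁻¹ * C (2 : 𝕜)⁻¹ - 2 * C (6 : 𝕜)⁻¹ - C (6 : 𝕜)⁻¹ * C (6 : 𝕜)⁻¹ * X ^ 2) := by
    simp only [hp, add_comp, one_comp, X_comp, mul_comp, C_comp, pow_comp]
    ring
  have hc2 : (2 : 𝕜[X]) * C (2 : 𝕜)⁻¹ - 1 = 0 := by
    rw [← map_ofNat C 2, ← map_mul, mul_inv_cancel₀ h2, map_one, sub_self]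
  rw [e1, expT_eq_aeval, ← hp, ← map_mul, key, hc2, zero_mul, add_zero, map_add, map_one, map_mul, map_pow, aeval_X,
    pow_four_eq_zero h4 hx, zero_mul, add_zero]

/-- [folklore] `expT x · expT (−x) = 1` for `x ∈ 𝔪`. -/
theorem expT_mul_expT_neg (h2 : (2 : 𝕜) ≠ 0) {x : R} (hx : ag x = 0) : expT 𝕜 x * expT 𝕜 (-x) = 1 := by
  have hx' : ag (-x) = 0 := by rw [map_neg, hx, neg_zero]
  simpa only [neg_neg] using expT_neg_mul_expT h4 h2 hx'

omit h4 in
/-- [folklore] `ag (expT x) = 1` for `x ∈ 𝔪`. -/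
theorem aug_expT_eq_one {x : R} (hx : ag x = 0) : ag (expT 𝕜 x) = 1 := by
  rw [map_expT, hx, expT_zero]

/-- [folklore] **`invT (expT x) = expT (−x)`** for `x ∈ 𝔪` (uniqueness of inverses). -/
theorem invT_expT (h2 : (2 : 𝕜) ≠ 0) {x : R} (hx : ag x = 0) : invT (expT 𝕜 x) = expT 𝕜 (-x) :=
  (eq_invT_of_mul_eq_one h4 (aug_expT_eq_one hx) (expT_mul_expT_neg h4 h2 hx)).symm

/-- [folklore] **`logT (invT g) = −logT g`** for `g ∈ 1 + 𝔪` (characteristic `≠ 2`): with `n = g − 1`, in `𝕜[X]`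
`L(−X + X² − X³) = −L(X) + (1 − 2·2⁻¹)·X² + (2·2⁻¹ − 1)·X³ + X⁴·q(X)` and `n⁴ = 0`. -/
theorem logT_invT (h2 : (2 : 𝕜) ≠ 0) {g : R} (hg : ag g = 1) : logT 𝕜 (invT g) = -logT 𝕜 g := by
  have hn : ag (g - 1) = 0 := by rw [map_sub, map_one, hg, sub_self]
  set pL : 𝕜[X] := X - C (2 : 𝕜)⁻¹ * X ^ 2 + C (3 : 𝕜)⁻¹ * X ^ 3 with hpL
  set pI : 𝕜[X] := -X + X ^ 2 - X ^ 3 with hpI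
  have key : pL.comp pI = -pL + (1 - 2 * C (2 : 𝕜)⁻¹) * X ^ 2 + (2 * C (2 : 𝕜)⁻¹ - 1) * X ^ 3
      + X ^ 4 * ((3 * C (3 : 𝕜)⁻¹ - 3 * C (2 : 𝕜)⁻¹) + (2 * C (2 : 𝕜)⁻¹ - 6 * C (3 : 𝕜)⁻¹) * X
          + (7 * C (3 : 𝕜)⁻¹ - C (2 : 𝕜)⁻¹) * X ^ 2 - 6 * C (3 : 𝕜)⁻¹ * X ^ 3 + 3 * C (3 : 𝕜)⁻¹ * X ^ 4
          - C (3 : 𝕜)⁻¹ * X ^ 5) := by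
    simp only [hpL, hpI, add_comp, sub_comp, X_comp, mul_comp, C_comp, pow_comp]
    ring
  have hc2 : (1 : 𝕜[X]) - 2 * C (2 : 𝕜)⁻¹ = 0 := by
    rw [← map_ofNat C 2, ← map_mul, mul_inv_cancel₀ h2, map_one, sub_self]
  have hc3 : (2 : 𝕜[X]) * C (2 : 𝕜)⁻¹ - 1 = 0 := by
    rw [← map_ofNat C 2, ← map_mul, mul_inv_cancel₀ h2, map_one, sub_self]
  rw [logT_eq_aeval, invT_sub_one_eq_aeval (𝕜 := 𝕜), ← hpI, ← aeval_comp, ← hpL, key, hc2, hc3, logT_eq_aeval, ← hpL]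
  simp only [zero_mul, add_zero, map_add, map_neg, map_mul, map_pow, aeval_X, pow_four_eq_zero h4 hn]


omit h4 in
/-- [folklore] The characteristic identity `3⁻¹ + 6⁻¹ − 2·2⁻² = 0` (`𝕜` of characteristic `≠ 2, 3`). -/
theorem coeff_three_eq_zero (h2 : (2 : 𝕜) ≠ 0) (h3 : (3 : 𝕜) ≠ 0) :
    (3 : 𝕜)⁻¹ + (6 : 𝕜)⁻¹ - 2 * ((2 : 𝕜)⁻¹ * (2 : 𝕜)⁻¹) = 0 := by
  have h6 : (6 : 𝕜) ≠ 0 := by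
    rw [show (6 : 𝕜) = 2 * 3 by norm_num]; exact mul_ne_zero h2 h3
  field_simp
  norm_num

/-- [folklore] **`logT (expT x) = x`** for `x ∈ 𝔪` (characteristic `≠ 2, 3`): in `𝕜[X]`, `L(E(X) − 1) = X + (3⁻¹ + 6⁻¹ − 2·2⁻²)·X³ + X⁴·q(X)`. -/
theorem logT_expT (h2 : (2 : 𝕜) ≠ 0) (h3 : (3 : 𝕜) ≠ 0) {x : R} (hx : ag x = 0) : logT 𝕜 (expT 𝕜 x) = x := by
  set pL : 𝕜[X] := X - C (2 : 𝕜)⁻¹ * X ^ 2 + C (3 : 𝕜)⁻¹ * X ^ 3 with hpL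
  set pN : 𝕜[X] := X + C (2 : 𝕜)⁻¹ * X ^ 2 + C (6 : 𝕜)⁻¹ * X ^ 3 with hpN
  have eN : expT 𝕜 x - 1 = aeval x pN := by
    rw [expT_eq_aeval, hpN]; simp only [map_add, map_one, map_mul, map_pow, aeval_X, aeval_C]; abel
  have key : pL.comp pN = X + (C (3 : 𝕜)⁻¹ + C (6 : 𝕜)⁻¹ - 2 * (C (2 : 𝕜)⁻¹ * C (2 : 𝕜)⁻¹)) * X ^ 3
      + X ^ 4 * ((3 * C (2 : 𝕜)⁻¹ * C (3 : 𝕜)⁻¹ - 2 * C (2 : 𝕜)⁻¹ * C (6 : 𝕜)⁻¹ - C (2 : 𝕜)⁻¹ ^ 3)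
          + (3 * C (6 : 𝕜)⁻¹ * C (3 : 𝕜)⁻¹ + 3 * C (2 : 𝕜)⁻¹ ^ 2 * C (3 : 𝕜)⁻¹ - 2 * C (2 : 𝕜)⁻¹ ^ 2 * C (6 : 𝕜)⁻¹) * X
          + (6 * C (2 : 𝕜)⁻¹ * C (6 : 𝕜)⁻¹ * C (3 : 𝕜)⁻¹ - C (2 : 𝕜)⁻¹ * C (6 : 𝕜)⁻¹ ^ 2 + C (2 : 𝕜)⁻¹ ^ 3 * C (3 : 𝕜)⁻¹) * X ^ 2
          + (3 * C (6 : 𝕜)⁻¹ ^ 2 * C (3 : 𝕜)⁻¹ + 3 * C (2 : 𝕜)⁻¹ ^ 2 * C (6 : 𝕜)⁻¹ * C (3 : 𝕜)⁻¹) * X ^ 3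
          + 3 * C (2 : 𝕜)⁻¹ * C (6 : 𝕜)⁻¹ ^ 2 * C (3 : 𝕜)⁻¹ * X ^ 4 + C (6 : 𝕜)⁻¹ ^ 3 * C (3 : 𝕜)⁻¹ * X ^ 5) := by
    simp only [hpL, hpN, add_comp, sub_comp, X_comp, mul_comp, C_comp, pow_comp]
    ring
  have hc3 : C (3 : 𝕜)⁻¹ + C (6 : 𝕜)⁻¹ - 2 * (C (2 : 𝕜)⁻¹ * C (2 : 𝕜)⁻¹) = (0 : 𝕜[X]) := by
    rw [← map_mul, ← map_ofNat C 2, ← map_mul, ← map_add, ← map_sub, coeff_three_eq_zero h2 h3, map_zero]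
  rw [logT_eq_aeval, eN, ← aeval_comp, ← hpL, key, hc3]
  simp only [zero_mul, add_zero, map_add, map_mul, map_pow, aeval_X, pow_four_eq_zero h4 hx]

/-- [folklore] **`expT (logT g) = g`** for `g ∈ 1 + 𝔪` (characteristic `≠ 2, 3`): in `𝕜[X]`, `E(L(X)) = 1 + X + (3⁻¹ + 6⁻¹ − 2·2⁻²)·X³ + X⁴·q(X)`. -/
theorem expT_logT (h2 : (2 : 𝕜) ≠ 0) (h3 : (3 : 𝕜) ≠ 0) {g : R} (hg : ag g = 1) : expT 𝕜 (logT 𝕜 g) = g := by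
  have hn : ag (g - 1) = 0 := by rw [map_sub, map_one, hg, sub_self]
  set pL : 𝕜[X] := X - C (2 : 𝕜)⁻¹ * X ^ 2 + C (3 : 𝕜)⁻¹ * X ^ 3 with hpL
  set pE : 𝕜[X] := 1 + X + C (2 : 𝕜)⁻¹ * X ^ 2 + C (6 : 𝕜)⁻¹ * X ^ 3 with hpE
  have key : pE.comp pL = 1 + X + (C (3 : 𝕜)⁻¹ + C (6 : 𝕜)⁻¹ - 2 * (C (2 : 𝕜)⁻¹ * C (2 : 𝕜)⁻¹)) * X ^ 3
      + X ^ 4 * ((2 * C (2 : 𝕜)⁻¹ * C (3 : 𝕜)⁻¹ - 3 * C (2 : 𝕜)⁻¹ * C (6 : 𝕜)⁻¹ + C (2 : 𝕜)⁻¹ ^ 3)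
          + (3 * C (6 : 𝕜)⁻¹ * C (3 : 𝕜)⁻¹ - 2 * C (2 : 𝕜)⁻¹ ^ 2 * C (3 : 𝕜)⁻¹ + 3 * C (2 : 𝕜)⁻¹ ^ 2 * C (6 : 𝕜)⁻¹) * X
          + (C (2 : 𝕜)⁻¹ * C (3 : 𝕜)⁻¹ ^ 2 - 6 * C (2 : 𝕜)⁻¹ * C (6 : 𝕜)⁻¹ * C (3 : 𝕜)⁻¹ - C (2 : 𝕜)⁻¹ ^ 3 * C (6 : 𝕜)⁻¹) * X ^ 2
          + (3 * C (6 : 𝕜)⁻¹ * C (3 : 𝕜)⁻¹ ^ 2 + 3 * C (2 : 𝕜)⁻¹ ^ 2 * C (6 : 𝕜)⁻¹ * C (3 : 𝕜)⁻¹) * X ^ 3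
          - 3 * C (2 : 𝕜)⁻¹ * C (6 : 𝕜)⁻¹ * C (3 : 𝕜)⁻¹ ^ 2 * X ^ 4 + C (6 : 𝕜)⁻¹ * C (3 : 𝕜)⁻¹ ^ 3 * X ^ 5) := by
    simp only [hpL, hpE, add_comp, one_comp, X_comp, mul_comp, C_comp, pow_comp]
    ring
  have hc3 : C (3 : 𝕜)⁻¹ + C (6 : 𝕜)⁻¹ - 2 * (C (2 : 𝕜)⁻¹ * C (2 : 𝕜)⁻¹) = (0 : 𝕜[X]) := by
    rw [← map_mul, ← map_ofNat C 2, ← map_mul, ← map_add, ← map_sub, coeff_three_eq_zero h2 h3, map_zero]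
  have eg : g = aeval (g - 1) (1 + X : 𝕜[X]) := by rw [map_add, map_one, aeval_X, add_sub_cancel]
  rw [expT_eq_aeval, logT_eq_aeval, ← aeval_comp, ← hpE, ← hpL, key, hc3]
  conv_rhs => rw [eg]
  simp only [zero_mul, add_zero, map_add, map_one, map_mul, map_pow, aeval_X, pow_four_eq_zero h4 hn]

end ExpLog

/-! ## §3 Augmentation one for holonomies and for the rooted averaging -/

section AugOne

variable {ag : R →ₐ[𝕜] R₀} {d : ℕ}

/-- [folklore] Transporter pairs that are `≡ 1 mod 𝔪` on every bond have holonomies `≡ 1 mod 𝔪` along any list of oriented bond letters. -/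
theorem aug_holG_eq_one {G Gb : Form1 d R} (hG : ∀ κ x, ag (G κ x) = 1) (hGb : ∀ κ x, ag (Gb κ x) = 1)
    {P : (Fin d → ℤ) → Prop} {l : List (LetterGrp d)} (hl : LettersIn δ P l) : ag (holG G Gb l) = 1 := by
  rw [map_holG]
  have e1 : (fun κ x => ag (G κ x)) = fun _ _ => (1 : R₀) := by funext κ x; exact hG κ x
  have e2 : (fun κ x => ag (Gb κ x)) = fun _ _ => (1 : R₀) := by funext κ x; exact hGb κ x
  rw [e1, e2]
  exact holG_one hl

/-- [folklore] **`ag (Φ^ρ_b(G, Ḡ)) = 1`**: node 12b's rooted one-step averaging of transporters `≡ 1 mod 𝔪` is `≡ 1 mod 𝔪` (naturality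
`map_PhiGAt` + `PhiGAt_one`). -/
theorem aug_PhiGAt_eq_one {G Gb : Form1 d R} (hG : ∀ κ x, ag (G κ x) = 1) (hGb : ∀ κ x, ag (Gb κ x) = 1)
    (ρ : Fin d → ℤ) (L : ℕ) (μ : Fin d) (y : Fin d → ℤ) : ag (PhiGAt 𝕜 ρ G Gb L μ y) = 1 := by
  rw [map_PhiGAt]
  have e1 : (fun κ x => ag (G κ x)) = fun _ _ => (1 : R₀) := by funext κ x; exact hG κ x
  have e2 : (fun κ x => ag (Gb κ x)) = fun _ _ => (1 : R₀) := by funext κ x; exact hGb κ x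
  rw [e1, e2]
  exact PhiGAt_one ρ L μ y

end AugOne

/-! ## §4 The instance of record: node 12's `Rho 𝔸` with `augR` -/

section RhoInstance

variable {𝔸 : Type*} [Ring 𝔸] [Algebra 𝕜 𝔸]

/-- [folklore] **`Rho 𝔸` IS NIL-4 FOR `augR`**: a product of four (possibly distinct) elements of the augmentation ideal of
`Rho 𝔸 = 𝔸[τ₁, τ₂, ρ]` vanishes (generalises `AveragingThirdJet.Rho.nil4`, which is the case of four equal factors). -/
theorem nil4_augR (a b c e : Rho 𝔸) (ha : augR 𝕜 a = 0) (hb : augR 𝕜 b = 0) (hc : augR 𝕜 c = 0) (he : augR 𝕜 e = 0) :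
    a * b * c * e = 0 := by
  rw [augR_apply] at ha hb hc he
  refine TrivSqZeroExt.ext ?_ ?_
  · rw [dfst_mul, dfst_mul, dfst_mul, TrivSqZeroExt.fst_zero]
    exact mul4_eq_zero_l _ hb hc he
  · simp only [dsnd_mul, dfst_mul, add_mul, TrivSqZeroExt.snd_zero, mul3_eq_zero ha hb hc, zero_mul,
      mul4_eq_zero_r c.snd ha hb he, mul4_eq_zero_m b.snd ha hc he, mul4_eq_zero_l a.snd hb hc he, add_zero]

end RhoInstance

end Summit.QuantumFields.BalabanUV.Beta.TruncatedNil4Calculus
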